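import Mathlib

/-!
# STUB-IDEAS sketch k2 · g31 — road UTD ON THE PAGE (R195 ⊕ R192 ⊕ page-half of R170″)

Crux `stmt-BirchSwinnertonDyer-27851` (`PrintCf2.SplitBadTwoLowerHalfOfFacts`), stub of record
`stub_heegnerIndexLowerAtTwo` (skeleton sha16 `f2bd84c029a8a938`, NOT re-typed here).
This file types the *bookkeeping* of the k2·g31 literature transfer (de Shalit 1987 / LTYZ 2025 §7
↦ road UTD of `Ideas/stub-heegnerindexloweratwo-k3-g28.md`):

* §A  place-intrinsic interpolation range at a split place `P` (de Shalit II.4.14 (36): `0 ≤ -j < k`,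
      read on Galois characters `κ_P^k κ_{P̄}^j χ`, `κ_P` = character of the formal torsion AT `P`);
      the four characters of road UTD read at `v = 𝔮`; the direction test (`Tw_{ρ⁻¹}` in, `Tw_ρ` out).
* §B  the twist direction on the group algebra: `eval_χ ∘ Tw_ρ = eval_{χρ}` and `Tw_{ρ⁻¹} ∘ Tw_ρ = id`,
      so `Col := Tw_{ρ⁻¹} ∘ i ∘ tw⁻¹` evaluates `i(u)` at `χ·ρ⁻¹ = χ·κ_𝔮` (type `(1,0)`·finite, IN range).
* §C  located digits of atom Y at `p = 2`: the `12` is removable (dS p0069), the twisting digit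
      `δ_𝔞 = ψ(𝔞) − N𝔞` has `v₂ ≥ 1` forced and `= 1` attained at `𝔞 = (5)`, anomality index `N = 1`.
* §D  decidable checks behind the LTYZ 2025 Thm 7.1 hypothesis dictionary for `(ℚ(√−7), 49a1, p = 2)`.
* §F  wild Gauss digits at `2` (R200′(c)): conductor `4`/`8` Gauss sums `= 2^{n/2}·unit` in `ℤ[X]/(Φ)`,
      de Shalit's prefactor / net digits, key-uniformity in the tower.

Nothing here proves BSD or the stub; `lean check`: rc 0, no `sorry`.
-/

set_option linter.dupNamespace false

namespace Summit.BirchSwinnertonDyer.BirchSwinnertonDyer.Cruxes.SplitBadTwoLowerHalfOfFacts.UTDPageAuditK2G31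

/-! ## §A Place-intrinsic range bookkeeping (de Shalit II.1.1 p0032, II.4.14 (36) p0071) -/

/-- Exponents `(k, j)` of a Galois character `κ_P ^ k · κ_{P̄} ^ j · (finite order)` of
`Gal(K(𝔤p^∞)/K)` read AT a split place `P`: `κ_P` is the character of the formal (Lubin–Tate)
torsion `E[P^∞]` at `P`, `κ_P κ_{P̄} = χ_cyc`.  With de Shalit's `𝔭 := ι_p`-induced prime and
`φ(σ) = κ(σ)` (II.4.6 (14), II.4.7), this is his infinity type `(k, j)`, `ε((a)) = a^k ā^j`. -/
@[ext] structure PlaceType where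
  k : ℤ
  j : ℤ
deriving DecidableEq, Repr

instance : Add PlaceType := ⟨fun s t => ⟨s.k + t.k, s.j + t.j⟩⟩
instance : Neg PlaceType := ⟨fun t => ⟨-t.k, -t.j⟩⟩

@[simp] theorem add_k (s t : PlaceType) : (s + t).k = s.k + t.k := rfl
@[simp] theorem add_j (s t : PlaceType) : (s + t).j = s.j + t.j := rfl
@[simp] theorem neg_k (t : PlaceType) : (-t).k = -t.k := rfl
@[simp] theorem neg_j (t : PlaceType) : (-t).j = -t.j := rfl

/-- de Shalit II.4.14 (36): the two-variable measure `μ(𝔤𝔭̄^∞)` built AT `𝔭` interpolates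
exactly the types with `0 ≤ -j < k` (one-variable II.4.12 (31): `j = 0`, `k ≥ 1`). -/
def InRange (t : PlaceType) : Prop := 0 ≤ -t.j ∧ -t.j < t.k

instance (t : PlaceType) : Decidable (InRange t) := by unfold InRange; infer_instance

/-- de Shalit II.1.1 p0032 L16: `ε` is critical iff `k < 0 ≤ j` or `0 ≤ k, j < 0`; we add the
boundary convention that the interpolation range sits inside the second region or on `j = 0`. -/
def Critical (t : PlaceType) : Prop := (t.k < 0 ∧ 0 ≤ t.j) ∨ (0 ≤ t.k ∧ t.j < 0)

/-- Reading the SAME Galois character at the conjugate place swaps the exponents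
(`κ_P ↔ κ_{P̄}`); on grössencharacters this is `ε ↦ ε ∘ c`, `(k,j) ↦ (j,k)`. -/
def swap (t : PlaceType) : PlaceType := ⟨t.j, t.k⟩

@[simp] theorem swap_k (t : PlaceType) : (swap t).k = t.j := rfl
@[simp] theorem swap_j (t : PlaceType) : (swap t).j = t.k := rfl
@[simp] theorem swap_swap (t : PlaceType) : swap (swap t) = t := rfl

/-- The two Katz regions (measure at `P`, measure at `P̄`) are disjoint: no character is
interpolated by both `μ_{𝔤,𝔭}` and `μ_{𝔤,𝔭*}` (LTYZ (7.4)/(7.5) use both). -/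
theorem not_inRange_and_inRange_swap (t : PlaceType) : ¬ (InRange t ∧ InRange (swap t)) := by
  rintro ⟨⟨h1, h2⟩, ⟨h3, h4⟩⟩
  simp only [swap_j, swap_k] at h3 h4
  omega

/-- In-range types with `j ≠ 0` are critical in de Shalit's sense; `j = 0, k ≥ 1` is the
one-variable boundary line of II.4.12. -/
theorem critical_of_inRange_of_j_ne_zero (t : PlaceType) (h : InRange t) (hj : t.j ≠ 0) :
    Critical t := by
  unfold InRange at h; unfold Critical; omega

/-! ### The characters of road UTD, read at the étale prime `v = 𝔮` of the class
(de Shalit's construction prime `𝔭_dS := 𝔮`, LTYZ's `μ_{𝔤,𝔭*}`). -/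

/-- `χ_cyc = κ_𝔮 κ_𝔭`. -/
def chiCyc : PlaceType := ⟨1, 1⟩
/-- `κ_𝔮 = φ_W` (the `𝔮`-adic avatar of `ψ_W`; `= κ` of II.4.6 when `𝔭_dS = 𝔮`). -/
def kappaQ : PlaceType := ⟨1, 0⟩
/-- `κ_𝔭` = the character of `T(key) = T_𝔭 W |_{G_𝔮}` (étale at `𝔮` up to `χ_e`). -/
def kappaP : PlaceType := ⟨0, 1⟩
/-- `ρ(key) = κ_𝔮⁻¹`, defined by `T(key) = ℤ₂(1) ⊗ ρ(key)`. -/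
def rhoKey : PlaceType := ⟨-1, 0⟩
/-- a finite-order (cyclotomic) character `χ` contributes type `(0,0)`. -/
def finiteChar : PlaceType := ⟨0, 0⟩

/-- `T(key) = ℤ₂(1) ⊗ ρ(key)`:  `κ_𝔭 = χ_cyc · ρ(key)`. -/
theorem tkey_decomposition : kappaP = chiCyc + rhoKey := by decide

/-- `ρ(key)⁻¹ = κ_𝔮 = φ_W` (k3-g28: "ρ_W = φ_W⁻¹"). -/
theorem rhoKey_inv : -rhoKey = kappaQ := by decide

/-- R195 verdict, range half: `Col = Tw_{ρ⁻¹} ∘ i ∘ tw⁻¹` evaluates `i(u)` at `χ · ρ(key)⁻¹ = χ κ_𝔮`,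
type `(1,0)`: IN the range of II.4.14 (36) (and of II.4.12 (31), `j = 0`). -/
theorem utd_evaluation_inRange : InRange (finiteChar + -rhoKey) := by decide

/-- The wrong direction `Tw_ρ` would evaluate at `χ · ρ(key)`, type `(-1,0)`: OUT of range
(k3-g28 "cheapest falsifier"; this is what would have killed road UTD). -/
theorem wrong_direction_outOfRange : ¬ InRange (finiteChar + rhoKey) := by decide

/-- Untwisted elliptic units evaluate at `χ` itself, type `(0,0)`: OUT of range
(Kronecker-limit territory, critic K20). -/
theorem untwisted_outOfRange : ¬ InRange finiteChar := by decide

/-- The character of `T(key)` itself, read at `𝔮`, is `(0,1)`: OUT of range — so SOME twist is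
necessary on the K-side at `v`; read at the formal prime `𝔭` (Rubin's side) it is `(1,0)`: IN. -/
theorem tkey_char_outOfRange_at_q_inRange_at_p : ¬ InRange kappaP ∧ InRange (swap kappaP) := by
  decide

/-- The dyadic defect of de Shalit's congruence (40) is `2^j` (p0072–p0073); road UTD lives on
`j = 0`, where the defect is `2^0 = 1`. -/
theorem utd_dyadic_defect_trivial : (finiteChar + -rhoKey).j = 0 ∧ (2 : ℕ) ^ (0 : ℕ) = 1 := by
  decide

/-! ## §B The twist direction on the group algebra (R195, sign/direction half)

`Λ = k[G]`, `ρ χ : G →* kˣ`.  `Tw_ρ : g ↦ ρ(g) g` is a `k`-algebra endomorphism, `Tw_{ρ⁻¹}` its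
inverse, and evaluation at `χ` after `Tw_ρ` is evaluation at `χρ`.  Hence for the diagonal twist
`M(ρ) = M ⊗ k(ρ)` (on which `g` acts by `ρ(g) g`, i.e. the `k[G]`-structure pulled back along
`Tw_ρ`), the `k[G]`-linear Coleman map is `Col = Tw_{ρ⁻¹} ∘ i ∘ tw⁻¹` and
`eval_χ (Col m) = eval_{χρ⁻¹} (i (tw⁻¹ m))` — with `ρ = ρ(key) = κ_𝔮⁻¹` this is `χ κ_𝔮` (§A). -/

section Twist

variable (k G : Type*) [CommRing k] [CommGroup G]

open MonoidAlgebra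

/-- the twisting character as a hom into the group algebra: `g ↦ ρ(g) • g`. -/
noncomputable def twistGen (ρ : G →* kˣ) : G →* MonoidAlgebra k G where
  toFun g := single g ((ρ g : kˣ) : k)
  map_one' := by rw [map_one, Units.val_one, MonoidAlgebra.one_def]
  map_mul' g h := by rw [map_mul, Units.val_mul, single_mul_single]

/-- `Tw_ρ : k[G] →ₐ[k] k[G]`, `g ↦ ρ(g) • g`. -/
noncomputable def twistAlgHom (ρ : G →* kˣ) : MonoidAlgebra k G →ₐ[k] MonoidAlgebra k G :=
  MonoidAlgebra.lift k (MonoidAlgebra k G) G (twistGen k G ρ)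

@[simp] theorem twistAlgHom_single (ρ : G →* kˣ) (g : G) (c : k) :
    twistAlgHom k G ρ (single g c) = single g (c * (ρ g : k)) := by
  unfold twistAlgHom
  rw [MonoidAlgebra.lift_single]
  simp [twistGen]

/-- evaluation of a measure at a character: `eval_χ : k[G] →ₐ[k] k`, `g ↦ χ(g)`. -/
noncomputable def evalChar (χ : G →* kˣ) : MonoidAlgebra k G →ₐ[k] k :=
  MonoidAlgebra.lift k k G ((Units.coeHom k).comp χ)

@[simp] theorem evalChar_single (χ : G →* kˣ) (g : G) (c : k) :
    evalChar k G χ (single g c) = c * (χ g : k) := by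
  unfold evalChar
  rw [MonoidAlgebra.lift_single]
  simp

/-- DIRECTION LEMMA: `eval_χ ∘ Tw_ρ = eval_{χρ}`. -/
theorem evalChar_comp_twist (χ ρ : G →* kˣ) :
    (evalChar k G χ).comp (twistAlgHom k G ρ) = evalChar k G (χ * ρ) := by
  apply MonoidAlgebra.algHom_ext
  · intro g
    simp [mul_comm]
  · exact Subsingleton.elim _ _

theorem evalChar_twist_apply (χ ρ : G →* kˣ) (μ : MonoidAlgebra k G) :
    evalChar k G χ (twistAlgHom k G ρ μ) = evalChar k G (χ * ρ) μ := by
  rw [← evalChar_comp_twist]; rfl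

/-- `Tw_{ρ⁻¹} ∘ Tw_ρ = id`: the two twists are mutually inverse, so exactly one of them linearises
the diagonal twist `M ⊗ k(ρ)` — namely `Tw_{ρ⁻¹}` (see the module docstring). -/
theorem twist_inv_comp_twist (ρ : G →* kˣ) :
    (twistAlgHom k G ρ⁻¹).comp (twistAlgHom k G ρ) = AlgHom.id k (MonoidAlgebra k G) := by
  apply MonoidAlgebra.algHom_ext
  · intro g
    simp
  · exact Subsingleton.elim _ _

/-- Road UTD's evaluation: `Col(m) = Tw_{ρ⁻¹}(i u)` evaluated at `χ` is `i u` evaluated at `χ ρ⁻¹`;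
with `ρ = κ⁻¹` (`T(key) = ℤ₂(1) ⊗ κ_𝔮⁻¹`) this is `χ κ` — the avatar of `χ ψ_W`, type `(1,0)`. -/
theorem utd_col_evaluates_at_chi_kappa (χ κ : G →* kˣ) (iu : MonoidAlgebra k G) :
    evalChar k G χ (twistAlgHom k G (κ⁻¹)⁻¹ iu) = evalChar k G (χ * κ) iu := by
  have h : (κ⁻¹)⁻¹ = κ := inv_inv κ
  rw [h, evalChar_twist_apply]

/-- … whereas the wrong direction `Tw_ρ = Tw_{κ⁻¹}` evaluates at `χ κ⁻¹` (type `(-1,0)`, §A). -/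
theorem wrong_direction_evaluates_at_chi_kappa_inv (χ κ : G →* kˣ) (iu : MonoidAlgebra k G) :
    evalChar k G χ (twistAlgHom k G κ⁻¹ iu) = evalChar k G (χ * κ⁻¹) iu :=
  evalChar_twist_apply k G χ κ⁻¹ iu

/-- The twisting measure `δ_𝔞 = σ_𝔞 − N𝔞` (de Shalit II.4.12, p0067; sign as in II.4.14 Step 1,
`μ_𝔞 = 12 (σ_𝔞 − N𝔞) μ(𝔣)`) evaluated at `χ`: `χ(σ_𝔞) − N𝔞`.  At unit grade the sign is invisible
(`-1 ∈ Λˣ`); the VALUE is the digit of §C. -/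
theorem eval_twisting_measure (χ : G →* kˣ) (σa : G) (Na : k) :
    evalChar k G χ (single σa 1 - algebraMap k (MonoidAlgebra k G) Na) = (χ σa : k) - Na := by
  rw [map_sub, evalChar_single, one_mul, AlgHom.commutes, Algebra.algebraMap_self_apply]

theorem eval_twisting_measure_neg (χ : G →* kˣ) (σa : G) (Na : k) :
    evalChar k G χ (algebraMap k (MonoidAlgebra k G) Na - single σa 1) = -((χ σa : k) - Na) := by
  rw [← eval_twisting_measure k G χ σa Na, ← map_neg, neg_sub]

end Twist

/-! ## §C Located digits of atom Y at `p = 2` (page-half of R170″)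

* `12`: removable — for `(𝔞, 6𝔣𝔭) = 1`, `β(𝔞)` is a 12th power in `𝒰` (de Shalit II.2.7, p0069 L7–9),
  so `i(β(𝔞)) = 12 · i(β(𝔞)^{1/12})` and the 12th root carries `δ_𝔞 μ(𝔣)` with no `12`.
* `δ_𝔞` at road UTD's evaluation point `χ = 𝟙`: `ψ_W(𝔞) − N𝔞`, `2`-adically via `ι_𝔮`.
  Floor: `v₂ ≥ 1` for EVERY admissible `𝔞` (full 2-torsion of the class over `K₀ = ℚ(√−7)`,
  LTYZ p0040 L50–51; equivalently `κ_𝔮 ≡ χ_cyc (mod 2)`, de Shalit I.3.7 `N(γ) ≡ κ(γ) mod p^N`).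
  Attained: `𝔞 = (5)`, `ψ_W((5)) = (5/7)·5 = −5`, `δ = −30`, `v₂ = 1`.
* anomality index of `Ê_{49a1}` at `𝔮`: `N = v₂(ψ(𝔭) − 1) = 1` (`a₂ = 1`), cokernel `(ℤ₂/2)(1)`. -/

/-- `12` is not a digit: an additive Coleman map sends a 12th power to `12 •` the image of the root. -/
theorem twelve_removable {U Λ : Type*} [CommGroup U] [AddCommGroup Λ] (i : Additive U →+ Λ)
    (β' : U) : i (Additive.ofMul (β' ^ 12)) = 12 • i (Additive.ofMul β') := by
  rw [ofMul_pow, map_nsmul]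

/-- Floor of the twisting digit: `ψ(𝔞) ≡ 1` and `N𝔞 ≡ 1 (mod 2)` force `2 ∣ ψ(𝔞) − N𝔞`
(integer model of the `ι_𝔮`-adic values). -/
theorem delta_digit_floor (x n : ℤ) (hx : x % 2 = 1) (hn : n % 2 = 1) : (2 : ℤ) ∣ x - n := by
  omega

/-- `(5/7) = −1`: `5` is not a square mod `7`, so `ε_{49a1}(5) = −1` and `ψ_W((5)) = −5` for every
member `W = 49a1^{(d)}` (`χ_d(25) = 1`). -/
theorem five_nonsquare_mod_seven : ¬ IsSquare (5 : ZMod 7) := by decide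

/-- The attained digit: `δ_{(5)}(𝟙) = ψ_W((5)) − N(5) = −5 − 25 = −30 = 2 · (−15)`, `−15` odd:
`v₂ = 1`. -/
theorem delta_at_five : (-5 : ℤ) - 25 = 2 * (-15) ∧ Odd (-15 : ℤ) := by decide

/-- k3-g28's choice (`a ≡ 5 mod 8`, `ε(a) = +1`) gives `v₂(a(ε(a) − a)) = 2` exactly, the choice
`ε(a) = −1` gives `1`: the table behind "4 = 2 + 2 is not minimal; 1 is". -/
theorem delta_digit_table (t : ℤ) :
    (8 * t + 5) * (1 - (8 * t + 5)) = -4 * ((8 * t + 5) * (2 * t + 1)) ∧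
      Odd ((8 * t + 5) * (2 * t + 1)) ∧
    (8 * t + 5) * (-1 - (8 * t + 5)) = -2 * ((8 * t + 5) * (4 * t + 3)) ∧
      Odd ((8 * t + 5) * (4 * t + 3)) := by
  refine ⟨by ring, ?_, by ring, ?_⟩
  · exact Int.odd_mul.mpr ⟨⟨4 * t + 2, by ring⟩, ⟨t, by ring⟩⟩
  · exact Int.odd_mul.mpr ⟨⟨4 * t + 2, by ring⟩, ⟨2 * t + 1, by ring⟩⟩

/-- Anomality index of `Ê_{49a1}` at `𝔮` (de Shalit I.3.7): with `ψ(𝔭) + ψ(𝔮) = a₂ = 1` and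
`ψ(𝔮) = 2u`, `u` odd (via `ι_𝔮`), one gets `ψ(𝔭) ≡ 3 (mod 4)`, hence `ψ(𝔭) − 1 = 2·(odd)`:
`N = 1`, cokernel `(ℤ₂/2)(1)` — finite, so atom Y `⊗ ℚ` is exact (R192). -/
theorem anomality_index_one (a b u : ℤ) (hsum : a + b = 1) (hb : b = 2 * u) (hu : u % 2 = 1) :
    a % 4 = 3 ∧ ∃ m : ℤ, a - 1 = 2 * m ∧ m % 2 = 1 := by
  refine ⟨by omega, ⟨-u, by omega, by omega⟩⟩

/-- At `p = 2` every good ORDINARY prime is ANOMALOUS (`a₂` odd ⇒ `a₂ ≡ 1 mod 2`): the cokernel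
`(O_K/2^N)(1)` of de Shalit's `i` is never trivial at `p = 2` — a structural dyadic digit. -/
theorem ordinary_at_two_is_anomalous (a : ℤ) (h : Odd a) : a % 2 = 1 % 2 := by
  obtain ⟨m, rfl⟩ := h; omega

/-! ## §D Decidable checks behind the LTYZ 2025 Thm 7.1 hypothesis dictionary
for `(K₀, A, p) = (ℚ(√−7), 49a1, 2)` — the auxiliary curve of road UTD (NOT `W`, which is additive). -/

/-- `49a1`: `[a₁,a₂,a₃,a₄,a₆] = [1,−1,0,−2,−1]`. -/
def A49 : WeierstrassCurve ℚ := ⟨1, -1, 0, -2, -1⟩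

theorem A49_b : A49.b₂ = -3 ∧ A49.b₄ = -4 ∧ A49.b₆ = -4 ∧ A49.b₈ = -1 := by
  refine ⟨?_, ?_, ?_, ?_⟩ <;>
  norm_num [A49, WeierstrassCurve.b₂, WeierstrassCurve.b₄, WeierstrassCurve.b₆, WeierstrassCurve.b₈]

/-- `Δ(49a1) = −343 = −7³`: good reduction away from `7`, in particular GOOD at `2`
(LTYZ Thm 7.1 at `p = 2` demands good ordinary reduction — met by `A`, violated by `W`). -/
theorem A49_discr : A49.Δ = -343 ∧ (-343 : ℤ) = -7 ^ 3 ∧ ¬ (2 : ℤ) ∣ -343 := by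
  refine ⟨?_, by norm_num, by decide⟩
  norm_num [A49, WeierstrassCurve.Δ, WeierstrassCurve.b₂, WeierstrassCurve.b₄, WeierstrassCurve.b₆,
    WeierstrassCurve.b₈]

/-- The 2-division cubic of `49a1` is `4x³ − 3x² − 8x − 4`. -/
theorem A49_twoTorsionPolynomial : A49.twoTorsionPolynomial = ⟨4, -3, -8, -4⟩ := by
  have h := A49_b
  simp only [WeierstrassCurve.twoTorsionPolynomial, h.1, h.2.1, h.2.2.1]
  norm_num

open Polynomial in
/-- … and it SPLITS over `ℚ(√−7)`: `4x³ − 3x² − 8x − 4 = (x − 2)(4x² + 5x + 2)` with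
`disc(4x² + 5x + 2) = −7`.  So every member `W = 49a1^{(d)}` has `W[2] ⊂ W(ℚ(√−7))`
(LTYZ p0040 L50–51), which is the floor `v₂(δ_𝔞) ≥ 1` of §C. -/
theorem A49_twoTorsion_splits_over_K0 :
    (4 * X ^ 3 - 3 * X ^ 2 - 8 * X - 4 : ℤ[X]) = (X - 2) * (4 * X ^ 2 + 5 * X + 2) ∧
      (5 : ℤ) ^ 2 - 4 * 4 * 2 = -7 := by
  exact ⟨by ring, by norm_num⟩

/-- `#Ẽ(𝔽₂) = 1 + 1 = 2` for `49a1` (one affine point), so `a₂ = 2 + 1 − 2 = 1`: ordinary (odd),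
anomalous (`≡ 1 mod 2`), and `2` splits in `ℚ(√−7)` (`−7 ≡ 1 mod 8`). -/
theorem A49_pointcount_F2 :
    (Finset.univ.filter (fun P : ZMod 2 × ZMod 2 =>
        P.2 ^ 2 + P.1 * P.2 = P.1 ^ 3 - P.1 ^ 2 - 2 * P.1 - 1)).card = 1 ∧
      (2 : ℤ) + 1 - (1 + 1) = 1 ∧ (-7 : ℤ) % 8 = 1 := by
  refine ⟨by decide, by norm_num, by decide⟩

/-- Conductor bookkeeping: `N(49a1) = 49 = N(𝔣_ψ)·|d_K|` forces `N(𝔣_ψ) = 7`, i.e. `𝔣_{ψ_A} = (√−7)`,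
prime to `2`; LTYZ's `f_A^{(2)} ∣ 𝔤` is met by `𝔤 = 𝔤_W = √−7 · (odd part of d)`. -/
theorem A49_conductor_bookkeeping (n : ℕ) (h : n * 7 = 49) : n = 7 ∧ Nat.Coprime 7 2 := by
  refine ⟨by omega, by decide⟩

/-- `w_K = 2` for `K₀ = ℚ(√−7)` (`d_K ∉ {−3, −4}`), so `p = 2 ∣ w_K`: LTYZ Lemma 7.3 (stated for
`p ≠ 2`, uses `p ∤ w`) is NOT available, and Thm 7.1 at `p = 2` instead assumes GOOD reduction so
that no twist `ϵ` and no period comparison are needed.  Recorded as the arithmetic fact `2 ∣ 2`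
next to `d_K = −7 ∉ {−3,−4}`. -/
theorem wK_two : (-7 : ℤ) ≠ -3 ∧ (-7 : ℤ) ≠ -4 ∧ (2 : ℕ) ∣ 2 := by decide

/-! ## §F Wild Gauss digits at `2` (R200′(c): de Shalit's normalisation)

de Shalit II.4.8 (19) p0061: `τ(χ) = p^{-n} Σ_γ χ(γ) ζ_n^{-κ(γ)}` (= `2^{-n}·χ_D(-1)·g(χ_D)`, `χ_D = χ∘κ⁻¹`);
II.4.11 (30) p0065 / II.4.14 (37) p0071: `G(ε) = φ^k φ̄^j(𝔭^n) p^{-n} · Σ_{γ∈S} χ(γ)(ζ_n^γ)^{-1}`,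
`G(ε) Ḡ(ε) = p^{n(k-1)}`.  For a primitive character of conductor `2^n`, `n ≥ 2`, the Gauss sum is
`2^{n/2} × (unit)` at EVERY prime above `2` (Lang, Cyclotomic Fields I–II, Ch. 3 Thm 1.2 (iii):
`S S̄ = 2^n`; the unit statement by the coset computation on `1 + 2^{⌈n/2⌉}ℤ/2^n`).  Kernel-visible
instances in `ℤ[ζ] = ℤ[X]/(Φ)`: conductor `4` (`v₂ = 1`) and the two conductor-`8` characters
(`g = 2w`, `w² = ±2`, `v₂ = 3/2`).  Net digits at road UTD's points `(k,j) = (1,0)` under `ι_𝔭`: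
prefactor `v_𝔭(φ(𝔭^n)/2^n) = n - n = 0` (but `-n` at `𝔭̄`), Gauss part `n/2`: `v_𝔭 G(ε) = n/2`,
`v τ_dS = -n/2`; and `n = max(m, n(key)) = m` high in the tower: KEY-UNIFORM. -/

open Polynomial in
/-- conductor `4`: `g(χ₄) = ζ − ζ³ ≡ 2ζ (mod ζ² + 1)`: `v₂ = 1 = n/2`. -/
theorem gauss_conductor4 : (X - X ^ 3 : ℤ[X]) = 2 * X - X * (X ^ 2 + 1) := by ring

open Polynomial in
/-- conductor `8`, even character `χ₈ = (1,−1,−1,1)`: `g = ζ − ζ³ − ζ⁵ + ζ⁷ ≡ 2w`, `w = ζ − ζ³`,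
`w² ≡ 2 (mod ζ⁴ + 1)`: `v₂(g) = 3/2 = n/2`. -/
theorem gauss_conductor8_even :
    (X - X ^ 3 - X ^ 5 + X ^ 7 : ℤ[X]) = 2 * (X - X ^ 3) + (X ^ 4 + 1) * (X ^ 3 - X) ∧
      ((X - X ^ 3) ^ 2 : ℤ[X]) = 2 + (X ^ 4 + 1) * (X ^ 2 - 2) := ⟨by ring, by ring⟩

open Polynomial in
/-- conductor `8`, odd character `χ₋₈ = (1,1,−1,−1)`: `g ≡ 2w'`, `w' = ζ + ζ³`, `w'² ≡ −2`:
`v₂(g) = 3/2 = n/2`. -/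
theorem gauss_conductor8_odd :
    (X + X ^ 3 - X ^ 5 - X ^ 7 : ℤ[X]) = 2 * (X + X ^ 3) - (X ^ 4 + 1) * (X ^ 3 + X) ∧
      ((X + X ^ 3) ^ 2 : ℤ[X]) = -2 + (X ^ 4 + 1) * (X ^ 2 + 2) := ⟨by ring, by ring⟩

/-- de Shalit's prefactor `φ(𝔭^n)/p^n` at `(k,j) = (1,0)`: valuation `n − n = 0` at the construction
prime `𝔭` (`v_𝔭 φ(𝔭) = 1`), `0 − n = −n` at `𝔭̄` — the place digit of (30)/(37). -/
theorem deShalit_prefactor_digits (n : ℤ) : n - n = 0 ∧ (0 : ℤ) - n = -n := by omega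

/-- Net: `v_𝔭 G(ε) = −n + n + n/2 = n/2` and `v τ_dS = −n + n/2 = −n/2` (normalisation (19)). -/
theorem deShalit_net_gauss_digit (n : ℚ) : -n + n + n / 2 = n / 2 ∧ -n + n / 2 = -(n / 2) := by
  constructor <;> ring

/-- In the cyclotomic tower the `𝔭`-exponent of `cond(χ φ_W)` is `max m n(key) = m` as soon as
`m > 3 ≥ n(key)` (`n(key) ∈ {2,3}`: receptacles `K_∞(μ₄)`, `K_∞(μ₈)`): the Gauss digit is key-uniform. -/
theorem tower_conductor_uniform (m nkey : ℕ) (h : nkey ≤ 3) (hm : 3 < m) : max m nkey = m := by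
  omega

/-! ## §E The audit record (what the critic can tick) -/

/-- The page audit of road UTD as data: the evaluation type, and the two facts it must satisfy. -/
structure UTDPageAudit where
  /-- type of the character at which `Col(u_W)` evaluates de Shalit's measure (§A/§B) -/
  evalType : PlaceType
  /-- it lies in the range of II.4.14 (36) -/
  inRange : InRange evalType
  /-- it lies on the one-variable line `j = 0` (dyadic defect `2^j = 1`) -/
  onLine : evalType.j = 0

/-- R195 executed: road UTD's evaluation point passes. -/
def utdAudit : UTDPageAudit where
  evalType := finiteChar + -rhoKey
  inRange := utd_evaluation_inRange
  onLine := utd_dyadic_defect_trivial.1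

/-- … and no audit record exists for the wrong direction or for untwisted units. -/
theorem no_audit_for_wrong_direction (A : UTDPageAudit) :
    A.evalType ≠ finiteChar + rhoKey ∧ A.evalType ≠ finiteChar := by
  constructor
  · intro h; exact wrong_direction_outOfRange (h ▸ A.inRange)
  · intro h; exact untwisted_outOfRange (h ▸ A.inRange)

end Summit.BirchSwinnertonDyer.BirchSwinnertonDyer.Cruxes.SplitBadTwoLowerHalfOfFacts.UTDPageAuditK2G31
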